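import Summits.Ventures.GridStability.Bench.NE39SPPolytopeRateCentral
import Summits.Ventures.GridStability.Lyapunov.StructurePreservingRateTree
import HarnessLib

/-!
# GridStability/Bench/NE39SPPolytopeRateTree — «SP-RATE-POLYTOPE» at 39-bus size with the TREE
# leaf-Poincaré pair: ★ #126's sentence with the line-branch constant `88·ΣD/β` replaced by
# `740·D_max/β` (`740 = 4·Σ depth` of the centrally rooted BFS tree), for EVERY damping vector `D > 0`

Cell `gridfusion` (LADDER-GRIDFUSION), seat gridfusion-lyap-1 (g8). ★ #126 (`Bench.NE39SP.polytope_energy_decay`,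
p563451) uses the diameter pair (`88·ΣD/β`; `56·ΣD/β` with the central tree, `…RateCentral`). The tree pair of
`Lyapunov/StructurePreservingRateTree.lean` (`sum_D_sq_le_of_tree`: `Σ Dᵢφᵢ² ≤ (4·D_max·Σdepth/β)·Q + (2Σ_gen M/ΣD)·K`,
g3's `TreePoincare`) on the centrally rooted BFS tree `parentC/depthC` (root bus 36, EXACT BFS depths,
`Σ depth = 185`) gives `A = 740·D_max/β` for ANY bound `Dᵢ ≤ D_max` — for a uniform damping vector
`Dᵢ = d` this is `740·d/β` against `56·49·d/β = 2744·d/β` (×3.7) and the original `4312·d/β` (×5.8).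
CONTENTS: `depthC_exact` / `tree_lower` (the tree hypotheses, `decide` + model-2's `edge_lower`),
`sum_depthC` (`Σ depth = 185`), **`polytope_energy_decay_tree`** (★ #126's sentence with
`88·ΣD/β ↦ 740·D_max/β`). Illustrative uniform `Dᵢ = d = 1/20` pu (VALIDATED, exact from the four
inequalities): line branch `ρ ≤ 0.00881 s⁻¹` (vs `0.00669` with `88`, `0.00749` with `56`), kinetic branch
`0.00928` — the two branches are now within 5 %. THREE COLUMNS as in ★ #126; nothing here says the New
England system is stable or well damped. No named fact; standard axioms.
[cite: Khalil2002, Theorem 4.10]; [cite: VuTuritsyn2016, §IV]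
-/

noncomputable section

open Set Filter Topology Real Finset
open Summit.Ventures.GridStability.Models
open Summit.Ventures.GridStability.Models.StructurePreserving
open Summit.Ventures.GridStability.Models.NE39SP
open Summit.Ventures.GridStability.Lyapunov.StructurePreserving (EdgeRateCert
  energy_le_mul_exp_neg_of_isSolution_vt sum_D_sq_le_of_tree)
open Literature.MathematicalPhysics.PowerSystems.ClassicalModel.LosslessSystem (vtGap)

namespace Summit.Ventures.GridStability.Bench.NE39SP

/-! ### The tree hypotheses of the centrally rooted BFS tree -/

/-- The depths of `parentC` are EXACT BFS depths: `depth root = 0`, `depth (parent v) + 1 = depth v` off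
the root (49 `decide` checks). CERTIFIED. [folklore] -/
theorem depthC_exact : depthC 35 = 0 ∧ ∀ v : Fin 49, v ≠ 35 → depthC (parentC v) + 1 = depthC v :=
  ⟨by decide, fun v hv => (by decide : ∀ v : Fin 49, v ≠ 35 → depthC (parentC v) + 1 = depthC v) v hv⟩

/-- Every tree edge carries a coupling `≥ β = betaLF` (column LF; the tree edge is a listed edge, model-2's
`edge_lower`). CERTIFIED. [folklore] -/
theorem tree_lower (D : Fin 49 → ℝ) :
    ∀ v : Fin 49, v ≠ 35 → (betaLF : ℝ) ≤ (params D).b v (parentC v) := by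
  intro v hv
  have hne : parentC v ≠ v := (by decide : ∀ v : Fin 49, v ≠ 35 → parentC v ≠ v) v hv
  have hb' : (params D).b (parentC v) v ≠ 0 := by
    rw [params_b]
    refine symmetrize_edgeWeight_ne_zero_of_edge wt_nonneg (treeEdgeC v) (wt_pos _) ?_
    exact (by decide : ∀ v : Fin 49, v ≠ 35 →
      (srcV (treeEdgeC v) = parentC v ∧ tgtV (treeEdgeC v) = v)
        ∨ (srcV (treeEdgeC v) = v ∧ tgtV (treeEdgeC v) = parentC v)) v hv
  have hadj : (params D).couplingGraph.Adj v (parentC v) :=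
    (((params D).couplingGraph_adj_of_symm b_symm (parentC v) v).2 ⟨hne, hb'⟩).symm
  exact edge_lower D v (parentC v) hadj

/-- `Σᵢ depthC i = 185`. CERTIFIED. -/
theorem sum_depthC : ∑ i, (depthC i : ℝ) = 185 := by
  have h : ∑ i, depthC i = 185 := by decide
  exact_mod_cast h

/-! ### ★ #126's sentence with the tree constant `740·D_max/β` -/

/-- **NE39-SP (column LF): exponential decay of the energy on the polytope region of level `15` with the
TREE line-branch constant `740·D_max/β`** — ★ #126's `polytope_energy_decay` with the diameter pair replaced
by the tree pair: for every `D` with `0 < Dᵢ ≤ D_max`, every `h > 0` with `2hMᵢ ≤ Dᵢ` on the ten machines,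
every `ρ ≥ 0` and `C` with `ρ(2 + h·2(7827/1885)/ΣD) ≤ 2h`, `ρ(1 + h·(740·D_max/β)/(299/1000)) ≤ h`,
`2 + h·2(7827/1885)/ΣD ≤ C`, `1 + h·(740·D_max/β)/(299/1000) ≤ C`: every solution from
`{V ≤ 15} ∩ 𝒫 ∩ leaf` obeys `V(δ₀; δ(t), δ̇(t)) ≤ 3C·V(δ₀; δ(0), δ̇(0))·exp(−ρt)` for all `t ≥ 0`.
CERTIFIED for MODEL M′ only; nothing here says the New England system is stable or well damped.
[cite: Khalil2002, Theorem 4.10]; [cite: VuTuritsyn2016, §IV]; [cite: Padiyar2013, App. D, §3.2] -/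
theorem polytope_energy_decay_tree {D : Fin 49 → ℝ} (hD : ∀ i, 0 < D i) {Dmax : ℝ}
    (hDmax : ∀ i, D i ≤ Dmax) {h : ℝ} (hh : 0 < h)
    (hhM : ∀ i ∈ genS, 2 * h * (MQ i : ℝ) ≤ D i) {ρ : ℝ} (hρ0 : 0 ≤ ρ)
    (hρK : ρ * (2 + h * (2 * (7827 / 1885 : ℝ) / (∑ i, D i))) ≤ 2 * h)
    (hρW : ρ * (1 + h * (740 * Dmax / (betaLF : ℝ)) / (299 / 1000)) ≤ h)
    {C : ℝ} (hCK : 2 + h * (2 * (7827 / 1885 : ℝ) / (∑ i, D i)) ≤ C)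
    (hCW : 1 + h * (740 * Dmax / (betaLF : ℝ)) / (299 / 1000) ≤ C)
    {δ : ℝ → Fin 49 → ℝ} (hδ : (params D).IsSolution δ)
    (hpol : ∀ i j, (params D).b i j ≠ 0 → |(δ 0 i - δ 0 j) + (NE39SP.δ₀ i - NE39SP.δ₀ j)| < π)
    (hL : (params D).momentum (δ 0) (fun i => deriv (fun u => δ u i) 0)
      = (params D).momentum NE39SP.δ₀ 0)
    (hV : (params D).energy NE39SP.δ₀ (δ 0) (fun i => deriv (fun u => δ u i) 0) ≤ 15)
    {t : ℝ} (ht : 0 ≤ t) :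
    (params D).energy NE39SP.δ₀ (δ t) (fun i => deriv (fun u => δ u i) t)
      ≤ 3 * C * (params D).energy NE39SP.δ₀ (δ 0) (fun i => deriv (fun u => δ u i) 0)
        * Real.exp (-ρ * t) := by
  obtain ⟨ℓ, u, hc⟩ := exists_cert D
  have hs : (params D).shifted.IsSolution δ := by
    rw [(params D).shifted_eq_self_of_P0_eq_pe NE39SP.b_symm (NE39SP.params_P0 D)]
    exact hδ
  have hb : ∀ i j, 0 ≤ (params D).b i j := fun i j => by rw [params_b]; exact b_nonneg i j
  have hhM' : ∀ i ∈ (params D).gen, 2 * h * (params D).M i ≤ (params D).D i := hhM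
  have hDmax0 : 0 ≤ Dmax := (hD 0).le.trans (hDmax 0)
  have hA : (0 : ℝ) ≤ 740 * Dmax / (betaLF : ℝ) := by
    have := beta_pos
    positivity
  have hPoinc : ∀ x : (Fin 49 → ℝ) × (Fin 49 → ℝ),
      x ∈ Lyapunov.StructurePreserving.constraintSet (params D) NE39SP.δ₀ →
      ∑ i, (params D).D i * (x.1 i - NE39SP.δ₀ i) ^ 2
        ≤ 740 * Dmax / (betaLF : ℝ)
            * ((1 / 2) * ∑ i, ∑ j, (params D).b i j
              * (((x.1 i - x.1 j) - (NE39SP.δ₀ i - NE39SP.δ₀ j)) ^ 2 / 2))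
          + 2 * (7827 / 1885 : ℝ) / (∑ i, D i) * (params D).kinetic x.2 := by
    intro x hx
    have h1 := sum_D_sq_le_of_tree (wellFormed hD) (by decide) hb beta_pos 35 parentC depthC
      depthC_exact.1 depthC_exact.2 (tree_lower D) (Dmax := Dmax) (fun i => hDmax i) hx
    rw [sum_gen_M D, sum_depthC] at h1
    have e2 : (∑ i, (params D).D i) = ∑ i, D i := rfl
    rw [e2] at h1
    have e1 : (4 : ℝ) * Dmax * 185 / (betaLF : ℝ) = 740 * Dmax / (betaLF : ℝ) := by ring
    rw [e1] at h1
    exact h1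
  have hρW' : ρ * (1 + h * (740 * Dmax / (betaLF : ℝ)) / (299 / 1000)) ≤ h * 1 := by
    rw [mul_one]; exact hρW
  have hcgap : ∀ i j, (params D).b i j ≠ 0 →
      (15 : ℝ) < (params D).b i j * vtGap (NE39SP.δ₀ i - NE39SP.δ₀ j) :=
    fun i j hij => lt_trans (by norm_num) (level_lt_edgeGap D i j hij)
  exact energy_le_mul_exp_neg_of_isSolution_vt (wellFormed hD) (by decide) (preconnected D) hb
    (window_strict D) (isSyncEquilibrium D) hcgap hc (by norm_num) hh hhM' hA hPoinc hρ0 hρK hρW'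
    hCK hCW hs hpol hL hV ht

end Summit.Ventures.GridStability.Bench.NE39SP

end
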